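import Mathlib
import Summits.Ventures.PercRepro.TriangleCapHangFamilyLift

/-!
# PercRepro — THE LINE `k − r = 6` EXPLICITLY: THE EXTREMAL GRAPHS ARE THE STAR-SHAPED ONES AND THE HANG
FAMILY (p3, gen 42; part 174)

The recursion `line_eq_iff` of part 171 (extremal ⟺ star-shaped ∨ a hanging on an extremal graph one step
down) UNROLLS: `line_eq_iff_explicit` — a `K₄⁻`-free graph on `k ≥ 7` vertices with `2k − 3` edges attains
`Σ_v d(v)² = m k − 5 (k − 6)` iff it is `K_{3, k−3}` minus a star of `k − 6` edges at one vertex, or it is a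
HANG FAMILY graph: a six-set `C` on which it is cubic, a pair `x ≠ y` in `C`, and every other vertex
adjacent exactly to `x` and `y` (`HangOn`, part 172).  The proof is a strong induction on `k` through the
recursion: at `k = 7` the deleted graph has six vertices, nine edges and `Σ d² = 54`, so it is cubic
(`Σ (d − 3)² = 0`) and `D` is a hang family graph on it; at `k ≥ 8` the deleted graph is star-shaped or a hang
family graph by induction, and both shapes transport (part 173): the two neighbours of the hanging vertex
have degree `k − 4` in `D − z`, which in a hang family graph on `k − 1 ≥ 7` vertices singles out `x` and `y`
(`eq_pair_of_deg_of_hangOn`), and in a star-shaped graph forces them onto the small side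
(`star_of_del_star`).  Axioms: standard.
-/

namespace PercRepro

namespace TriangleCap

namespace C047

open Finset

universe u

variable {V : Type*} [Fintype V] [DecidableEq V]

omit [DecidableEq V] in
/-- **A SIX-VERTEX GRAPH WITH NINE EDGES AND `Σ d² = 54` IS CUBIC:** `Σ_v (d(v) − 3)² = 54 − 6·18 + 54 = 0`. -/
theorem cubic_of_six (D : SimpleGraph V) [DecidableRel D.Adj] (hc : Fintype.card V = 6)
    (hE : D.edgeFinset.card = 9) (hsq : ∑ v, deg D v * deg D v = 54) : ∀ v, deg D v = 3 := by
  have hsum : ∑ v, deg D v = 18 := by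
    have := sum_deg_eq D
    omega
  have key : ∑ v, ((deg D v : ℤ) - 3) ^ 2 = 0 := by
    have h1 : ∑ v, ((deg D v : ℤ) - 3) ^ 2 =
        ∑ v, (((deg D v * deg D v : ℕ) : ℤ) + 9) - ∑ v, 6 * ((deg D v : ℕ) : ℤ) := by
      rw [← sum_sub_distrib]
      apply sum_congr rfl
      intro v _
      push_cast
      ring
    rw [h1, sum_add_distrib, ← mul_sum, ← Nat.cast_sum, ← Nat.cast_sum, hsq, hsum, sum_const, card_univ, hc]
    norm_num
  intro v
  have h0 := (sum_eq_zero_iff_of_nonneg (fun v _ => sq_nonneg ((deg D v : ℤ) - 3))).mp key v (mem_univ v)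
  have h2 : (deg D v : ℤ) - 3 = 0 := pow_eq_zero_iff (two_ne_zero) |>.mp h0
  omega

/-- **THE UNROLLING, BY INDUCTION ON `k`:** an extremal `K₄⁻`-free graph of the line on `n + 7` vertices is
star-shaped or a hang family graph. -/
theorem line_explicit_aux (n : ℕ) :
    ∀ (V : Type u) [Fintype V] [DecidableEq V] (D : SimpleGraph V) [DecidableRel D.Adj],
      Fintype.card V = n + 7 → K4mFree D → D.edgeFinset.card + 3 = 2 * Fintype.card V →
      ∑ v, deg D v * deg D v + (Fintype.card V - 6) * 5 = D.edgeFinset.card * Fintype.card V →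
      (∃ (A : Finset V) (v : V), A.card = 3 ∧ BipSub D A ∧ MissingStar D A v) ∨ HangFamily D := by
  induction n with
  | zero =>
    intro V _ _ D _ hcard hK hm heq
    rcases (line_eq_iff D hK (by omega) hm).mp heq with hstar | ⟨z, hz2, -, heq'⟩
    · exact Or.inl hstar
    · right
      have hcard' := card_del z
      have hedges := card_edges_del D z
      have hc6 : Fintype.card {v : V // v ≠ z} = 6 := by omega
      have hE9 : (del D z).edgeFinset.card = 9 := by omega
      rw [hc6, hE9] at heq'
      simp only [Nat.sub_self, zero_mul, add_zero] at heq'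
      have hcub := cubic_of_six (del D z) hc6 hE9 heq'
      obtain ⟨p, q, hpq, hpz, hqz, hzw⟩ := nbhd_of_deg_two D hz2
      have h' : HangOn (del D z) univ ⟨p, hpz⟩ ⟨q, hqz⟩ :=
        ⟨by rw [card_univ, hc6], mem_univ _, mem_univ _, fun h => hpq (congrArg Subtype.val h),
          fun c _ => hcub c, fun w hw => absurd (mem_univ w) hw⟩
      exact ⟨_, _, _, hangOn_of_del D z h' hzw⟩
  | succ n ih =>
    intro V _ _ D _ hcard hK hm heq
    rcases (line_eq_iff D hK (by omega) hm).mp heq with hstar | ⟨z, hz2, hnb, heq'⟩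
    · exact Or.inl hstar
    · have hcard' := card_del z
      have hedges := card_edges_del D z
      have hK' := k4mFree_del D hK z
      have hm' : (del D z).edgeFinset.card + 3 = 2 * Fintype.card {v : V // v ≠ z} := by omega
      rcases ih {v : V // v ≠ z} (del D z) (by omega) hK' hm' heq' with hstar' | ⟨C', x', y', h'⟩
      · exact Or.inl (star_of_del_star D hK (by omega) hm heq z hnb hstar')
      · right
        obtain ⟨p, q, hpq, hpz, hqz, hzw⟩ := nbhd_of_deg_two D hz2
        -- a neighbour of `z` has degree `k − 4` in `D − z`, hence is `x'` or `y'`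
        have hpair : ∀ (w : V) (hw : w ≠ z), D.Adj z w →
            (⟨w, hw⟩ : {v : V // v ≠ z}) = x' ∨ (⟨w, hw⟩ : {v : V // v ≠ z}) = y' := by
          intro w hw hadj
          apply eq_pair_of_deg_of_hangOn (del D z) h' (by omega)
          have h1 := deg_del D z ⟨w, hw⟩
          have h2 := hnb ⟨w, hw⟩ (D.adj_symm hadj)
          rw [if_pos (D.adj_symm hadj)] at h1
          omega
        have hp := hpair p hpz ((hzw p).mpr (Or.inl rfl))
        have hq := hpair q hqz ((hzw q).mpr (Or.inr rfl))
        have hzw' : ∀ w, D.Adj z w ↔ (w = x'.1 ∨ w = y'.1) := by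
          intro w
          rw [hzw w]
          rcases hp with hp | hp <;> rcases hq with hq | hq
          · exfalso
            have hp1 : p = x'.1 := congrArg Subtype.val hp
            have hq1 : q = x'.1 := congrArg Subtype.val hq
            exact hpq (hp1.trans hq1.symm)
          · have hp1 : p = x'.1 := congrArg Subtype.val hp
            have hq1 : q = y'.1 := congrArg Subtype.val hq
            rw [hp1, hq1]
          · have hp1 : p = y'.1 := congrArg Subtype.val hp
            have hq1 : q = x'.1 := congrArg Subtype.val hq
            rw [hp1, hq1]
            exact or_comm
          · exfalso
            have hp1 : p = y'.1 := congrArg Subtype.val hp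
            have hq1 : q = y'.1 := congrArg Subtype.val hq
            exact hpq (hp1.trans hq1.symm)
        exact ⟨_, _, _, hangOn_of_del D z h' hzw'⟩

/-- **THE LINE `k − r = 6`, EXPLICITLY:** a `K₄⁻`-free graph on `k ≥ 7` vertices with `2k − 3` edges attains
`Σ_v d(v)² = m k − 5 (k − 6)` iff it is `K_{3, k−3}` minus a star of `k − 6` edges at one vertex, or it is a
hang family graph (a cubic six-core with every other vertex hung on one pair of the core). -/
theorem line_eq_iff_explicit (D : SimpleGraph V) [DecidableRel D.Adj] (hK : K4mFree D)
    (hk : 7 ≤ Fintype.card V) (hm : D.edgeFinset.card + 3 = 2 * Fintype.card V) :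
    ∑ v, deg D v * deg D v + (Fintype.card V - 6) * 5 = D.edgeFinset.card * Fintype.card V ↔
      (∃ (A : Finset V) (v : V), A.card = 3 ∧ BipSub D A ∧ MissingStar D A v) ∨ HangFamily D := by
  constructor
  · intro heq
    exact line_explicit_aux (Fintype.card V - 7) V D (by omega) hK hm heq
  · rintro (hstar | hhang)
    · exact (line_eq_iff D hK hk hm).mpr (Or.inl hstar)
    · exact line_eq_of_hangFamily D hm hhang

end C047

end TriangleCap

end PercRepro
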